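import Summits.BirchSwinnertonDyer.BirchSwinnertonDyer.Theorems.SylvesterTwoHeegnerIndexCoupledTelescopeStep
import HarnessLib

/-!
# The COUPLED Cassels–Tate telescope, X-c: SUPPLYING `hlift` — admissible Selmer lifts of the same
# `2`-power order by lifting over `ℚ` and restricting (generic-witness form; pure algebra)

Crux `UpperOffV0HSYPlus` (stmt-BirchSwinnertonDyer-19804); companion of `…CoupledTelescopeLiftPackage`
(`exists_lift_family`, whose one arithmetic input per basis vector is
`hlift : ∀ c ∈ L, ∀ k, 2^k • c = 0 → ∃ s ∈ Sel, s ∈ Adm ∧ τ s = ι (r c) ∧ 2^k • s = 0`).  On HSY's frame the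
rows obtain such lifts by (1) lifting `c ∈ L ≤ Ш(X/ℚ)[2^∞]` to the `ℚ`-Selmer group at level `n`
(the tree's `map_torsionH1ToH1_selmerGroup_holds`: `Sel_n(X/ℚ) ↠ Ш(X/ℚ)[n]`), (2) correcting the lift
inside the kernel `δ(X(ℚ)/n)` — ONE cyclic generator `y` of exponent exactly `2^T = n` on `B = E_p`
(rank one over `ℚ`, no rational `2`-torsion), the zero group on `A = E_{3p²}` (rank zero) — so that it
has the same `2`-power order as `c` (McCallum p. 288; the one-generator form of p696786's
`exists_lift_pow_smul_eq_zero`), and (3) restricting to `K` (restrictions of `ℚ`-Selmer classes are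
Selmer and ADMISSIBLE, and `torsionH1ToH1` commutes with restriction).  This file is that deduction
with every map and consumed property a BINDER (planner D586): abstract groups `SQ` (for `H¹(ℚ, X[n])`),
`QQ` (for `H¹(ℚ, X)`), `M₀` (for `Ш(X/ℚ)[2^∞]`), and `S, M, Q` as in `…LiftPackage`.

* `exists_lift_of_sub_kernel` — the one-generator exact-order correction: `τQ (2^k • u) = 0`, kernel
  `ℤ·y` with `a • y = 0 → 2^T ∣ a` (or `y = 0`), `2^T SQ = 0`, `k ≤ T` ⊢ `u'` with `τQ u' = τQ u`,
  `2^k • u' = 0`, `u - u' ∈ ℤ·y`.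
* `hlift_of_rational_lift` — (1)+(2)+(3) ⊢ `hlift` in `exists_lift_family`'s exact shape.

Theorem-only (no definition, no named fact); nothing asserted on 19804; no stub closed; BSD not claimed
for any curve.  Sources: McCallum 1991 §5 (p. 288: «let `c_i` be a lifting of `d_i` to `S_∞(E/K)`»);
MEMO-bsd-cm-two §59.2.
-/

-- every Summits module is named `Summit.<Summit>.<Problem>…`: the duplicated component is by design
set_option linter.dupNamespace false
set_option autoImplicit false

namespace Summit.BirchSwinnertonDyer.BirchSwinnertonDyer.Theorems.SylvesterTwoCoupledTelescope

section LiftSupply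

variable {SQ QQ M₀ S M Q : Type*} [AddCommGroup SQ] [AddCommGroup QQ] [AddCommGroup M₀]
  [AddCommGroup S] [AddCommGroup M] [AddCommGroup Q]

/-- **Exact-order correction inside a cyclic kernel** (one-generator form of p696786's
`exists_lift_pow_smul_eq_zero`): if `τQ (2^k • u) = 0`, the kernel of `τQ` on `SelQ` is `ℤ·y` with `y`
free of exponent `2^T` (or `y = 0`), `2^T` kills `SQ` and `k ≤ T`, then some `u' = u - a' • y` has
`τQ u' = τQ u` and `2^k • u' = 0`. [cite: McCallumLMS1991, §5 Thm. 5.4 (proof, p. 288)] -/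
theorem exists_lift_of_sub_kernel (SelQ : AddSubgroup SQ) (τQ : SQ →+ QQ) (y : SQ) (hy : y ∈ SelQ)
    (hτy : τQ y = 0) (T : ℕ) (hfree : ∀ a : ℤ, a • y = 0 → ((2 : ℤ) ^ T ∣ a) ∨ y = 0)
    (htors : ∀ u : SQ, ((2 : ℤ) ^ T) • u = 0)
    (hker : ∀ u ∈ SelQ, τQ u = 0 → ∃ a : ℤ, u = a • y)
    {u : SQ} (hu : u ∈ SelQ) {k : ℕ} (hk : k ≤ T) (hku : τQ (((2 : ℤ) ^ k) • u) = 0) :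
    ∃ u' ∈ SelQ, τQ u' = τQ u ∧ ((2 : ℤ) ^ k) • u' = 0 ∧ ∃ a' : ℤ, u' = u - a' • y := by
  obtain ⟨a, ha⟩ := hker _ (SelQ.zsmul_mem hu _) hku
  -- `2^T u = 0` gives `2^{T-k} a • y = 0`, so `2^T ∣ 2^{T-k} a`, i.e. `2^k ∣ a` (or `y = 0`)
  have hpow : (2 : ℤ) ^ T = (2 : ℤ) ^ (T - k) * (2 : ℤ) ^ k := by
    rw [← pow_add, Nat.sub_add_cancel hk]
  have hzero : ((2 : ℤ) ^ (T - k) * a) • y = 0 := by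
    rw [mul_smul, ← ha, smul_smul, ← hpow, htors]
  rcases hfree _ hzero with ⟨a', ha'⟩ | hy0
  · have hp : (2 : ℤ) ^ (T - k) ≠ 0 := pow_ne_zero _ two_ne_zero
    have haeq : a = (2 : ℤ) ^ k * a' := mul_left_cancel₀ hp (by rw [ha', hpow, mul_assoc])
    refine ⟨u - a' • y, SelQ.sub_mem hu (SelQ.zsmul_mem hy _), by rw [map_sub, map_zsmul, hτy,
      smul_zero, sub_zero], ?_, a', rfl⟩
    rw [smul_sub, ha, haeq, mul_smul]
    exact sub_self _
  · refine ⟨u, hu, rfl, ?_, 0, by rw [zero_smul, sub_zero]⟩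
    rw [ha, hy0, smul_zero]

/-- **Supplying `hlift`** (the one arithmetic input of `…LiftPackage.exists_lift_family`) from a
`ℚ`-level lift and restriction: `L`'s elements lift to `SelQ` modulo `ιQ` (`hsurjQ`, the tree's Selmer
surjectivity over `ℚ`), the kernel of `τQ` on `SelQ` is cyclic `ℤ·y` free of exponent `2^T` (or zero)
with `2^T SQ = 0`, and a restriction `res : SQ →+ S` carries `SelQ` into
`Sel ∩ Adm` compatibly with `τ`, `ι`, `r` (`hcomp`).  Then every `c ∈ L` with `2^k • c = 0` has an
admissible lift `s ∈ Sel` with `τ s = ι (r c)` and `2^k • s = 0` (for `k > T` directly from `2^T SQ = 0`;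
no injectivity of `ιQ` and no exponent bound on `L` are needed).
[cite: McCallumLMS1991, §5 Thm. 5.4 (proof, p. 288)] -/
theorem hlift_of_rational_lift (L : AddSubgroup M₀) (ιQ : M₀ →+ QQ) (SelQ : AddSubgroup SQ)
    (τQ : SQ →+ QQ)
    (hsurjQ : ∀ c ∈ L, ∃ u ∈ SelQ, τQ u = ιQ c)
    (y : SQ) (hy : y ∈ SelQ) (hτy : τQ y = 0) (T : ℕ)
    (hfree : ∀ a : ℤ, a • y = 0 → ((2 : ℤ) ^ T ∣ a) ∨ y = 0)
    (htors : ∀ u : SQ, ((2 : ℤ) ^ T) • u = 0) (hker : ∀ u ∈ SelQ, τQ u = 0 → ∃ a : ℤ, u = a • y)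
    (r : M₀ →+ M) (ι : M →+ Q) (Sel : AddSubgroup S) (Adm : Set S) (τ : S →+ Q) (res : SQ →+ S)
    (hresSel : ∀ u ∈ SelQ, res u ∈ Sel) (hresAdm : ∀ u ∈ SelQ, res u ∈ Adm)
    (hcomp : ∀ u ∈ SelQ, ∀ c : M₀, τQ u = ιQ c → τ (res u) = ι (r c)) :
    ∀ c ∈ L, ∀ k : ℕ, ((2 : ℤ) ^ k) • c = 0 →
      ∃ s ∈ Sel, s ∈ Adm ∧ τ s = ι (r c) ∧ ((2 : ℤ) ^ k) • s = 0 := by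
  intro c hc k hkc
  obtain ⟨u, hu, hτu⟩ := hsurjQ c hc
  -- reduce to `k ≤ T`: for `k > T` the annihilation `2^k • s = 0` follows from `2^T SQ = 0`
  by_cases hk : k ≤ T
  · have hku : τQ (((2 : ℤ) ^ k) • u) = 0 := by
      rw [map_zsmul, hτu, ← map_zsmul, hkc, map_zero]
    obtain ⟨u', hu', hτu', hku', -⟩ :=
      exists_lift_of_sub_kernel SelQ τQ y hy hτy T hfree htors hker hu hk hku
    refine ⟨res u', hresSel _ hu', hresAdm _ hu', hcomp _ hu' c (hτu'.trans hτu), ?_⟩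
    rw [← map_zsmul, hku', map_zero]
  · refine ⟨res u, hresSel _ hu, hresAdm _ hu, hcomp _ hu c hτu, ?_⟩
    have hTk : T ≤ k := le_of_lt (not_le.mp hk)
    rw [← map_zsmul, show (2 : ℤ) ^ k = (2 : ℤ) ^ (k - T) * (2 : ℤ) ^ T by
      rw [← pow_add, Nat.sub_add_cancel hTk], mul_smul, htors, smul_zero, map_zero]

end LiftSupply

end Summit.BirchSwinnertonDyer.BirchSwinnertonDyer.Theorems.SylvesterTwoCoupledTelescope
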